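import Literature.AlgebraicGeometry.Morphisms.QuasiProjectiveMorphism
import HarnessLib

/-!
# Quasi-projective morphisms: from quasi-compact immersions, and composition with projective morphisms

Topic `Literature/AlgebraicGeometry/Morphisms`; theorems-only sequel of `Morphisms/QuasiProjectiveMorphism`
(`IsQuasiProjective f`: Hartshorne's quasi-projective morphisms, open immersion followed by a
projective morphism) and `Morphisms/ProjectiveMorphismComposition` (`IsProjective.comp` via the
Segre embedding over the base, `IsProjective.of_isPullback`).

* `IsQuasiProjective.of_isImmersion_comp` — **a quasi-compact immersion into a projective `S`-scheme
  has quasi-projective composite to `S`**: factor it through its scheme-theoretic image (Mathlib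
  `Scheme.Hom.toImage`, an open immersion for a quasi-compact immersion; `Scheme.Hom.imageι`, a
  closed immersion). This is the passage from Stacks' "H-quasi-projective" (Tag 01VW: a
  quasi-compact immersion into `𝐏ⁿ_S`) to Hartshorne's definition; the converse holds when the
  morphism is quasi-compact (`isQuasiProjective_and_quasiCompact_iff_exists_immersion`).
* `IsProjective.comp_isQuasiProjective` — **projective followed by quasi-compact quasi-projective is
  quasi-projective**: for `X ↪ 𝐏(ι; Y) → Y` (closed) and `Y ↪ P → S` (open, `P → S` projective),
  `X ↪ 𝐏(ι; Y) = Y ×_P 𝐏(ι; P) ↪ 𝐏(ι; P)` is a quasi-compact immersion (projective space commutes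
  with base change, `isPullback_projectiveSpaceMap`) into the projective `S`-scheme `𝐏(ι; P)`
  (`IsProjective.comp`). Quasi-compactness (automatic over Noetherian bases) is what makes the
  scheme-theoretic image behave; Hartshorne's definition omits it because his schemes are Noetherian.

NOT here: quasi-projective ∘ quasi-projective (needs an ample sheaf on the middle scheme).
Everything is proved; no definitions, no named facts.

## References

* R. Hartshorne, *Algebraic Geometry*, GTM 52 (1977), II §4 Definition p. 103. [Hartshorne1977]
* The Stacks Project, Tag 01VW (H-quasi-projective = quasi-compact immersion into `𝐏ⁿ_S`),
  Tag 01QV (scheme-theoretic image of a quasi-compact immersion). [StacksProject]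
-/

noncomputable section

-- Mathlib's pull-back API is stated through `abbrev`s over `limit`; as in Mathlib's own
-- algebraic-geometry files we let `simp`/unification see through them.
set_option backward.isDefEq.respectTransparency false

universe u

open CategoryTheory CategoryTheory.Limits AlgebraicGeometry

namespace Literature.AlgebraicGeometry.Morphisms

variable {X Y S : Scheme.{u}}

/-! ### Quasi-compact immersions into projective schemes -/

/-- **A quasi-compact immersion followed by a projective morphism is quasi-projective**: the
immersion is an open immersion onto its scheme-theoretic image, which is a closed subscheme of the
projective scheme (Stacks 01QV; Hartshorne II §4). [cite: StacksProject, Tag 01VW] -/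
theorem IsQuasiProjective.of_isImmersion_comp {P : Scheme.{u}} (i : X ⟶ P) [IsImmersion i]
    [QuasiCompact i] {p : P ⟶ S} (hp : IsProjective p) : IsQuasiProjective (i ≫ p) :=
  ⟨i.image, i.toImage, i.imageι ≫ p, inferInstance, hp.comp_isClosedImmersion i.imageι,
    by rw [i.toImage_imageι_assoc]⟩

/-- **Stacks' H-quasi-projective morphisms are quasi-projective**: a quasi-compact immersion into
`𝐏(ι; S)` over `S`. [cite: StacksProject, Tag 01VW] -/
theorem IsQuasiProjective.of_isImmersion_projectiveSpace (ι : Type u) [Finite ι] {f : X ⟶ S}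
    (i : X ⟶ projectiveSpace ι S) [IsImmersion i] [QuasiCompact i]
    (hi : i ≫ projectiveSpaceFst ι S = f) : IsQuasiProjective f := by
  rw [← hi]
  exact IsQuasiProjective.of_isImmersion_comp i (isProjective_projectiveSpaceFst ι S)

/-- Conversely a QUASI-COMPACT quasi-projective morphism is H-quasi-projective in the sense of
Stacks: it factors as a quasi-compact immersion into some `𝐏(ι; S)` over `S` (the open immersion of
the factorisation is quasi-compact by cancellation against the separated projective part).
[cite: StacksProject, Tag 01VW] -/
theorem IsQuasiProjective.exists_immersion_projectiveSpace {f : X ⟶ S} (hf : IsQuasiProjective f)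
    [QuasiCompact f] :
    ∃ (ι : Type u) (_ : Finite ι) (i : X ⟶ projectiveSpace ι S),
      IsImmersion i ∧ QuasiCompact i ∧ i ≫ projectiveSpaceFst ι S = f := by
  obtain ⟨P, i, p, hi, hp, hipf⟩ := hf
  obtain ⟨ι, hι, j, hj, hjp⟩ := hp
  haveI := hj
  haveI : IsSeparated p := by haveI := IsProjective.isProper ⟨ι, hι, j, hj, hjp⟩; infer_instance
  haveI : QuasiCompact (i ≫ p) := by rw [hipf]; infer_instance
  haveI : QuasiCompact i := QuasiCompact.of_comp i p
  exact ⟨ι, hι, i ≫ j, inferInstance, inferInstance, by rw [Category.assoc, hjp, hipf]⟩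

/-- **Hartshorne + quasi-compact = Stacks**: a morphism is quasi-projective and quasi-compact iff it
factors as a quasi-compact immersion into some `𝐏(ι; S)` over `S` (Stacks Tag 01VW,
"H-quasi-projective"). [cite: StacksProject, Tag 01VW] -/
theorem isQuasiProjective_and_quasiCompact_iff_exists_immersion (f : X ⟶ S) :
    (IsQuasiProjective f ∧ QuasiCompact f) ↔
      ∃ (ι : Type u) (_ : Finite ι) (i : X ⟶ projectiveSpace ι S),
        IsImmersion i ∧ QuasiCompact i ∧ i ≫ projectiveSpaceFst ι S = f := by
  constructor
  · rintro ⟨hf, hq⟩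
    exact hf.exists_immersion_projectiveSpace
  · rintro ⟨ι, hι, i, hi, hq, hif⟩
    refine ⟨IsQuasiProjective.of_isImmersion_projectiveSpace ι i hif, ?_⟩
    rw [← hif]
    infer_instance

/-! ### Projective followed by quasi-projective -/

/-- **A projective morphism followed by a quasi-compact quasi-projective morphism is
quasi-projective**: `X ↪ 𝐏(ι; Y) = Y ×_P 𝐏(ι; P) ↪ 𝐏(ι; P) → P → S` — a quasi-compact immersion
(closed, then the base change of the open `Y ↪ P`) into the projective `S`-scheme `𝐏(ι; P)`
(Hartshorne II §4; Stacks 01VW). [cite: Hartshorne1977, II Ex. 4.9] -/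
theorem IsProjective.comp_isQuasiProjective {Z : Scheme.{u}} {f : X ⟶ Y} {g : Y ⟶ Z}
    (hf : IsProjective f) (hg : IsQuasiProjective g) [QuasiCompact g] :
    IsQuasiProjective (f ≫ g) := by
  obtain ⟨P, i, p, hi, hp, hipg⟩ := hg
  obtain ⟨ι, hι, j, hj, hjf⟩ := hf
  haveI := hj
  -- `i : Y ↪ P` is a quasi-compact open immersion
  haveI : IsSeparated p := by haveI := hp.isProper; infer_instance
  haveI : QuasiCompact (i ≫ p) := by rw [hipg]; infer_instance
  haveI : QuasiCompact i := QuasiCompact.of_comp i p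
  -- `𝐏(ι; Y) ↪ 𝐏(ι; P)`, the base change of `i`, is a quasi-compact open immersion
  have hP := isPullback_projectiveSpaceMap ι i
  haveI : IsOpenImmersion (projectiveSpaceMap ι i) := MorphismProperty.of_isPullback hP.flip hi
  haveI : QuasiCompact (projectiveSpaceMap ι i) := MorphismProperty.of_isPullback hP.flip inferInstance
  -- `𝐏(ι; P) → P → S` is projective
  have hproj : IsProjective (projectiveSpaceFst ι P ≫ p) :=
    (isProjective_projectiveSpaceFst ι P).comp hp
  -- the quasi-compact immersion `X ↪ 𝐏(ι; Y) ↪ 𝐏(ι; P)`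
  have key := IsQuasiProjective.of_isImmersion_comp (j ≫ projectiveSpaceMap ι i) hproj
  have hfac : (j ≫ projectiveSpaceMap ι i) ≫ projectiveSpaceFst ι P ≫ p = f ≫ g := by
    rw [Category.assoc, projectiveSpaceMap_fst_assoc, ← Category.assoc, hjf, hipg]
  rwa [hfac] at key

/-- **A projective morphism to a quasi-compact quasi-projective `S`-scheme is quasi-projective over
`S`** (restatement for structure morphisms; the form F-9-type arguments use: `Z⁰ → A⁰` projective,
`A⁰ → S` quasi-projective and quasi-compact ⇒ `Z⁰ → S` quasi-projective).
[cite: Hartshorne1977, II Ex. 4.9] -/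
theorem IsQuasiProjective.of_isProjective_over {Z : Scheme.{u}} {f : X ⟶ Y} {g : Y ⟶ Z}
    {h : X ⟶ Z} (hfg : f ≫ g = h) (hf : IsProjective f) (hg : IsQuasiProjective g)
    [QuasiCompact g] : IsQuasiProjective h := by
  rw [← hfg]
  exact hf.comp_isQuasiProjective hg

end Literature.AlgebraicGeometry.Morphisms

end
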